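import Literature.AnabelianGeometry.EtaleTheta.ConstantsDictionaryWitness
import Literature.AnabelianGeometry.EtaleTheta.SettingModelChiThetaCocycleSec
import Literature.AnabelianGeometry.EtaleTheta.SettingModelChiCyclotomes

/-!
# [EtTh] §5 ↔ §3: the predicate `ConstantsDictionary` is SATISFIABLE — over every theta setting's own §2 model, and
# binder-free at the record model `modelχ` (Def. 3.6 (iii)/(iv) p. 304, Lemma 5.8 p. 331 / PDF pp. 78, 105)

Mochizuki, *The étale theta function and its Frobenioid-theoretic manifestations*, Publ. RIMS **45** (2009)
[cite: MochizukiEtTh2009, Lem 5.8 p.331 (PDF p.105)].  abc-iut cell, layer L2, seat abc-iut-L2-t11 (gen 5); row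
«NV-CONSTANTS-DICTIONARY» (census cell B10 «satisfiable»).  PROOF-ONLY companion (0 definitions) of this seat's
`ConstantsDictionaryWitness.lean` (the terms: `CnstToy.datum`, `CnstToy.act`, `CnstToy.muEquiv`, `CnstToy.reading`) and of the
FROZEN predicate `ThetaFrobenioid.BiratAutAction.ConstantsDictionary` (`ConstantsDictionary.lean`, p439403); the record model
`modelχ` and its §1/§2 package are abc-iut-L2-t1, -L2-d1, -L2-t6, -L2-t8 and -f-150's, consumed BY NAME (`SettingModel.doubleUnderlineχSec`,
`ThetaSetting.modelχ_sec2Hyps`, `SettingModel.modelχ_nonempty_cyclotomeMod`).  Nothing landed is edited or restated.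

RESULTS.
* `datum_eq_ofThetaEnvData` — the datum IS abc-iut-L2-t4's `ThetaFrobenioid.ofThetaEnvData` over `T := Cu.thetaEnvData μ hC hS`
  (so `identifiesPiY_ofThetaEnvData` / `identifiesPiYdd_ofThetaEnvData` apply to it: two more consumer binders vanish);
* `homOf_sgpCap_rho`, `act_act_apply`, `coe_muEquiv`, `coe_reading`, `reading_injective` — bookkeeping;
* `roots_of_K_datum` — `B_N`'s constants contain an `N`-th root of every `k ∈ K^×` (`ℚ̄_p` algebraically closed;
  `x^N ∈ K ⊆ K_N ⇒ x ∈ J_N`);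
* `identifiesPiY_datum`, `identifiesPiYdd_datum` — the junction binders `IdentifiesPiY` / `IdentifiesPiYdd` HOLD for the datum
  with `ι := refl` (abc-iut-L2-t4's / this lineage's dictionary hypotheses of Lemma 5.9 (iv));
* **`constantsDictionary_datum`** — with constants `Cst := ⊤ = J_N^×`, ALL ELEVEN law fields of `ConstantsDictionary` hold for
  `(datum, act, refl, muEquiv, ⊤, reading)`: `O^×(B_N), K^×, (K^×)^{1/N} ⊆ Cst`, `Aut_C(B_N)`-stability, injectivity, the
  `G_K`-EQUIVARIANCE "`Π^tp_Y` [i.e., `G_K`, via the natural surjection `Π^tp_Y ↠ G_K`] acts" (by construction: `ρ` is the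
  restriction of the Galois action), `mu_compat` / `constEmb_read` / `reaches_K` (definitionally), `roots_of_K`;
* `exists_constantsDictionary` — census form, binders = the construction data `(D, E, Cu, N, μ, hC, hS)` only;
* **`exists_constantsDictionary_modelχ`** — census form AT THE RECORD MODEL `modelχ p`, binder-free: for every prime `p`, odd `l`,
  level `N` there exist the cyclotome identification and a §5 datum over `(doubleUnderlineχSec p l hl).thetaEnvData μ _ _`
  satisfying `ConstantsDictionary`.
So the ONE binder `hD : ConstantsDictionary α Cu μ hC hS ι m Cst ν̃` of every §5 ↔ §2 consumer
(`Discharge/Sec5OfConstantsDictionary.lean`, `…/Sec5Lem59ivOfThetaSetting.lean`, `…/Sec5Thm510iiiKummerOutRepresentative.lean`)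
is CONSISTENT with the setting's own §2 model, at a setting satisfying `IsEtThOrigin` / `Sec2Hyps`.
HONEST LABEL: consistency / non-vacuity evidence; the §5 datum is a toy (NOT the tempered Frobenioid of a curve) and `modelχ`
is a semi-synthetic model of the typed §1 interface; nothing of [EtTh] is asserted; typed ≠ proved; no side is taken on
anything downstream ([IUTchIII] Cor. 3.12).
-/

noncomputable section

namespace Literature.AnabelianGeometry.EtaleTheta

open CategoryTheory Literature.AnabelianGeometry.SemiGraphs IntermediateField

namespace ThetaFrobenioid

namespace CnstToy

variable {p : ℕ} [Fact p.Prime] (D : ThetaSetting p) (N : ℕ+)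

/-- The reading on elements. [cite: MochizukiEtTh2009, Def 3.6 (iv) p.304 (PDF p.78)] -/
theorem coe_reading (x : (⊤ : Subgroup (J D N)ˣ)) :
    ((reading D N x : (PadicAlgCl p)ˣ) : PadicAlgCl p) = (((x : (J D N)ˣ) : J D N) : PadicAlgCl p) := rfl

/-- The reading is injective. [cite: MochizukiEtTh2009, Def 3.6 (iv) p.304 (PDF p.78)] -/
theorem reading_injective : Function.Injective (reading D N) :=
  (Units.map_injective (f := (algebraMap (J D N) (PadicAlgCl p)).toMonoidHom) Subtype.val_injective).comp
    Subtype.val_injective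

variable {D N} {E : D.EtaleThetaData} {l : ℕ} (Cu : E.DoubleUnderline l) (μ : D.CyclotomeMod l N)
  (hC : D.Compat) (hS : D.Sec2Hyps)

/-- **The datum IS abc-iut-L2-t4's `ThetaFrobenioid.ofThetaEnvData` over `T := Cu.thetaEnvData μ hC hS`** (so every lemma
about such data — `identifiesPiY_ofThetaEnvData`, `identifiesPiYdd_ofThetaEnvData`, … — applies to it); the fields are spelled
out above only so that they reduce by `rfl` in the computations below.  [cite: MochizukiEtTh2009, §5 p.330–332 (PDF pp.104–106)] -/
theorem datum_eq_ofThetaEnvData : datum Cu μ hC hS =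
    ThetaFrobenioid.ofThetaEnvData (stub D N) (subquot D N) l Cu.l_odd N (Cu.thetaEnvData μ hC hS)
      (SingleObj.star _) (SingleObj.star _) (SingleObj.star _) (𝟙 _) (𝟙 _) rfl
      ⟨rfl, show IsIso ((Toy.pre (π D N)).base.map (𝟙 _)) from inferInstance⟩
      ⟨rfl, show IsIso ((Toy.pre (π D N)).base.map (𝟙 _)) from inferInstance⟩
      (rho Cu μ hC hS) (rho_surjective Cu μ hC hS) (isOpen_ker_rho Cu μ hC hS) 1 (sgpCap (D := D) (N := N)) 1
      D.K (constEmb D N) (constEmb_injective D N) 1 :=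
  rfl

/-- The level of the datum is `N` and its `Π^tp_X̲` is `Π^tp_X̲̲ = Cu.Huu` (definitional bookkeeping).
[cite: MochizukiEtTh2009, §5 p.330 (PDF p.104)] -/
theorem datum_N_PiX : (datum Cu μ hC hS).N = N ∧ (datum Cu μ hC hS).PiX = Cu.Huu := ⟨rfl, rfl⟩


/-- `s^⊓-gp_N(ρ y) = inr(restr(aug y))`. [cite: MochizukiEtTh2009, Lem 5.9 (iii) p.332 (PDF p.106)] -/
theorem homOf_sgpCap_rho (y : (datum Cu μ hC hS).PiX) :
    Toy.homOf (G D N) _ ((datum Cu μ hC hS).sgpCap ((datum Cu μ hC hS).ρ y)) =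
      SemidirectProduct.inr ((restr D N).rangeRestrict ((Cu.thetaEnvData μ hC hS).aug y)) := by
  change Toy.homOf (G D N) _ (Toy.autEquiv (G D N) (SemidirectProduct.inr ((Toy.autEquiv (Gam D N)).symm
    (Toy.autEquiv (Gam D N) ((restr D N).rangeRestrict ((Cu.thetaEnvData μ hC hS).aug y)))))) = _
  rw [MulEquiv.symm_apply_apply, Toy.homOf_autEquiv]


/-- The action of `act` on elements. [cite: MochizukiEtTh2009, Def 4.1 (iii) p.313 (PDF p.87)] -/
theorem act_act_apply (e : Aut (datum Cu μ hC hS).BN) (f : (J D N)ˣ) :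
    (act Cu μ hC hS).act e f =
      Units.map ((π D N (Toy.homOf (G D N) _ e) : (J D N) ≃ₐ[ℚ_[p]] (J D N)) : J D N →* J D N) f :=
  rfl


/-- `m` read in `ℚ̄_p^×`: the image of `u ∈ μ_N(B_N)` is its `μ_N(J_N)`-component. [cite: MochizukiEtTh2009, Lem 5.9 (iv) p.332 (PDF p.106)] -/
theorem coe_muEquiv (u : (datum Cu μ hC hS).muTorsion (datum Cu μ hC hS).BN (datum Cu μ hC hS).N) :
    ((muEquiv Cu μ hC hS u : MuN p N) : (PadicAlgCl p)ˣ) =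
      Units.map (algebraMap (J D N) (PadicAlgCl p)).toMonoidHom
        ((ul Cu μ hC hS (Subgroup.inclusion ((datum Cu μ hC hS).muTorsion_le_units _ _) u) : Mu D N) : (J D N)ˣ) :=
  rfl



/-- **`B_N`'s constants contain an `N`-th root of every element of `K^×`** (Def. 5.4: `B_N` is `(l,N)`-theta-saturated;
Lemma 5.8 "`(K^×)^{1/N}/μ_N(B_N) ⥲ K^×`"), for the datum: `ℚ̄_p` is algebraically closed, and an `N`-th root `x` of `k ∈ K`
satisfies `x^N ∈ K ⊆ K_N`, so `x ∈ J_N`.  [cite: MochizukiEtTh2009, Lem 5.8 p.331 (PDF p.105)] -/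
theorem roots_of_K_datum (y : (D.K)ˣ) : ∃ f : (datum Cu μ hC hS).KxRootN,
    ((reading D N ⟨(f : (datum Cu μ hC hS).biratUnits (datum Cu μ hC hS).BN), Subgroup.mem_top _⟩ :
      (PadicAlgCl p)ˣ) : PadicAlgCl p) ^ ((datum Cu μ hC hS).N : ℕ) = algebraMap D.K (PadicAlgCl p) (y : D.K) := by
  obtain ⟨x, hx⟩ : ∃ x : PadicAlgCl p, x ^ (N : ℕ) = ((y : D.K) : PadicAlgCl p) :=
    IsAlgClosed.exists_pow_nat_eq _ N.pos
  have hy0 : ((y : D.K) : PadicAlgCl p) ≠ 0 := fun h => y.ne_zero (Subtype.ext h)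
  have hx0 : x ≠ 0 := by
    rintro rfl
    rw [zero_pow N.ne_zero] at hx
    exact hy0 hx.symm
  have hxJ : x ∈ J D N :=
    IntermediateField.subset_adjoin ℚ_[p] _ (Set.mem_union_right _
      (show x ^ (N : ℕ) ∈ fieldKN D.K D.qX N from hx ▸ le_fieldKN D.K D.qX N (y : D.K).2))
  let f : (J D N)ˣ := Units.mk0 ⟨x, hxJ⟩ (fun h => hx0 (congrArg Subtype.val h))
  have hf : f ∈ (datum Cu μ hC hS).KxRootN :=
    (datum Cu μ hC hS).mem_KxRootN.mpr (MonoidHom.mem_range.mpr ⟨y, Units.ext (Subtype.ext hx.symm)⟩)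
  exact ⟨⟨f, hf⟩, hx⟩

/-! ### Two more junction binders vanish for the datum: `IdentifiesPiY`, `IdentifiesPiYdd` (with `ι := refl`) -/

/-- **`IdentifiesPiY` holds for the datum with `ι := refl`** (`Π^tp_Y̲ = Ker(Π^tp_X̲ ↠ ℤ) = T.PiY`, as abc-iut-L2-t4's
`identifiesPiY_ofThetaEnvData`). [cite: MochizukiEtTh2009, Lem 5.9 (iv) p.332 (PDF p.106)] -/
theorem identifiesPiY_datum :
    (datum Cu μ hC hS).IdentifiesPiY (Cu.thetaEnvData μ hC hS) (MulEquiv.refl _) := by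
  intro y
  change y ∈ (Cu.thetaEnvData μ hC hS).zquot.ker ↔ y ∈ (Cu.thetaEnvData μ hC hS).PiY
  rw [ThetaEnvData.ker_zquot]

/-- **`IdentifiesPiYdd` holds for the datum with `ι := refl`**. [cite: MochizukiEtTh2009, Lem 5.9 (iv) p.332 (PDF p.106)] -/
theorem identifiesPiYdd_datum :
    (datum Cu μ hC hS).IdentifiesPiYdd (Cu.thetaEnvData μ hC hS) (MulEquiv.refl _) :=
  fun _ => Iff.rfl

/-! ### Main theorem: the datum satisfies `ConstantsDictionary` -/

/-- **[EtTh] §5 ↔ §3, NON-VACUITY OF THE CONSTANTS DICTIONARY.**  For every theta setting `D`, étale theta datum `E`, choice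
`X̲̲`, level `N`, cyclotome identification `μ` and §1/§2 hypotheses `hC`, `hS`: the §5 datum `datum Cu μ hC hS` over the
setting's own §2 model `Cu.thetaEnvData μ hC hS` (`ι := refl`), with "the natural action" `act`, the cyclotome identification
`muEquiv`, constants `Cst := ⊤ = J_N^×` and reading `ν̃ := (J_N^× ↪ ℚ̄_p^×)`, SATISFIES abc-iut-L2-t11's predicate
`ConstantsDictionary` (all eleven laws: `O^×(B_N), K^×, (K^×)^{1/N} ⊆ Cst`; `Aut_C(B_N)`-stability; injectivity;
`G_K`-EQUIVARIANCE "`Π^tp_Y` [i.e., `G_K`, via the natural surjection `Π^tp_Y ↠ G_K`] acts"; compatibility with `m` on `μ_N(B_N)`;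
the constants `K` of the datum read onto `K ⊆ ℚ̄_p`; and `N`-th roots of `K^×` are constants — `ℚ̄_p` is algebraically closed and
`x^N ∈ K ⊆ K_N ⇒ x ∈ J_N`).  A consistency witness for the ONE binder `hD` of the §5 ↔ §2 consumers; NOT the tempered Frobenioid
of a curve.  [cite: MochizukiEtTh2009, Lem 5.8 p.331 (PDF p.105)] -/
theorem constantsDictionary_datum :
    (act Cu μ hC hS).ConstantsDictionary Cu μ hC hS (ContinuousMulEquiv.refl _) (muEquiv Cu μ hC hS) ⊤ (reading D N) where
  units_mem _ := Subgroup.mem_top _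
  constEmb_mem _ := Subgroup.mem_top _
  kxRootN_le := le_top
  act_mem _ _ _ := Subgroup.mem_top _
  injective := reading_injective D N
  equivariant y x := by
    refine Units.ext ?_
    simp only [act_act_apply, homOf_sgpCap_rho, SemidirectProduct.rightHom_inr,
      MonoidHom.coe_rangeRestrict, AlgEquiv.smul_units_def, Units.coe_map, MonoidHom.coe_coe]
    rfl
  mu_compat _ := rfl
  constEmb_read k := SetLike.coe_mem (k.val : D.K)
  reaches_K z := ⟨z, rfl⟩
  roots_of_K := roots_of_K_datum Cu μ hC hS

/-- **Census form (binders = the construction data only).**  For every theta setting and every `(E, X̲̲, N, μ, hC, hS)`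
there EXIST a §5 datum over the setting's §2 model `Cu.thetaEnvData μ hC hS` (namely `datum Cu μ hC hS`), a natural action,
an identification of `Π`'s (`refl`), a cyclotome identification, a subgroup of constants and a reading satisfying
`ConstantsDictionary`.  [cite: MochizukiEtTh2009, Lem 5.8 p.331 (PDF p.105)] -/
theorem exists_constantsDictionary :
    ∃ (α : (datum Cu μ hC hS).BiratAutAction) (ι : (datum Cu μ hC hS).PiX ≃ₜ* (Cu.thetaEnvData μ hC hS).PiX)
      (m : (datum Cu μ hC hS).muTorsion (datum Cu μ hC hS).BN (datum Cu μ hC hS).N ≃* (Cu.thetaEnvData μ hC hS).mu)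
      (Cst : Subgroup ((datum Cu μ hC hS).biratUnits (datum Cu μ hC hS).BN)) (ν' : Cst →* (PadicAlgCl p)ˣ),
      α.ConstantsDictionary Cu μ hC hS ι m Cst ν' :=
  ⟨_, _, _, _, _, constantsDictionary_datum Cu μ hC hS⟩

set_option maxHeartbeats 400000 in
/-- **Census form AT THE χ-TWISTED RECORD MODEL `modelχ p`, binder-free**: for every prime `p`, odd `l` and level `N`, with
abc-iut-L2-d1's choice `X̲̲ := doubleUnderlineχSec p l hl` (carrying the model's non-trivial theta class), abc-iut-L2-t8's
cyclotome identification (`modelχ_nonempty_cyclotomeMod`) and §1/§2 hypotheses (`modelχ_sec2Hyps`), the §5 datum over the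
record model's mono-theta environment `(doubleUnderlineχSec p l hl).thetaEnvData μ _ _` satisfies `ConstantsDictionary` — the
ONE binder `hD` of the §5 ↔ §2 consumers is satisfiable at a setting satisfying `IsEtThOrigin`/`Sec2Hyps` (HONEST LABEL: `modelχ`
is a semi-synthetic model of the typed §1 interface, and the §5 datum is a toy; consistency evidence only).
[cite: MochizukiEtTh2009, Lem 5.8 p.331 (PDF p.105)] -/
theorem exists_constantsDictionary_modelχ (p : ℕ) [Fact p.Prime] (l : ℕ+) (hl : Odd (l : ℕ)) (N : ℕ+) :
    ∃ (μ : (ThetaSetting.modelχ p).CyclotomeMod l N)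
      (α : (datum (SettingModel.doubleUnderlineχSec p l hl) μ (ThetaSetting.modelχ_sec2Hyps p).compat
        (ThetaSetting.modelχ_sec2Hyps p)).BiratAutAction)
      (ι : (datum (SettingModel.doubleUnderlineχSec p l hl) μ (ThetaSetting.modelχ_sec2Hyps p).compat
        (ThetaSetting.modelχ_sec2Hyps p)).PiX ≃ₜ*
          ((SettingModel.doubleUnderlineχSec p l hl).thetaEnvData μ (ThetaSetting.modelχ_sec2Hyps p).compat
            (ThetaSetting.modelχ_sec2Hyps p)).PiX)
      (m : (datum (SettingModel.doubleUnderlineχSec p l hl) μ (ThetaSetting.modelχ_sec2Hyps p).compat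
          (ThetaSetting.modelχ_sec2Hyps p)).muTorsion
            (datum (SettingModel.doubleUnderlineχSec p l hl) μ (ThetaSetting.modelχ_sec2Hyps p).compat
              (ThetaSetting.modelχ_sec2Hyps p)).BN N ≃*
          ((SettingModel.doubleUnderlineχSec p l hl).thetaEnvData μ (ThetaSetting.modelχ_sec2Hyps p).compat
            (ThetaSetting.modelχ_sec2Hyps p)).mu)
      (Cst : Subgroup ((datum (SettingModel.doubleUnderlineχSec p l hl) μ (ThetaSetting.modelχ_sec2Hyps p).compat
        (ThetaSetting.modelχ_sec2Hyps p)).biratUnits (SingleObj.star _)))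
      (ν' : Cst →* (PadicAlgCl p)ˣ),
      α.ConstantsDictionary (SettingModel.doubleUnderlineχSec p l hl) μ (ThetaSetting.modelχ_sec2Hyps p).compat
        (ThetaSetting.modelχ_sec2Hyps p) ι m Cst ν' := by
  obtain ⟨μ⟩ := SettingModel.modelχ_nonempty_cyclotomeMod p l.pos N
  exact ⟨μ, _, _, _, _, _, constantsDictionary_datum (SettingModel.doubleUnderlineχSec p l hl) μ
    (ThetaSetting.modelχ_sec2Hyps p).compat (ThetaSetting.modelχ_sec2Hyps p)⟩


end CnstToy

end ThetaFrobenioid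

end Literature.AnabelianGeometry.EtaleTheta

end
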